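import Summits.AtomisticToContinuum.Crystallization.Theorems.FrustratedLawDichotomyTwoShellRigidityDoor

/-!
# FrustratedLawDichotomy · beneath the two-shell kissing-rigidity door — THE CUT `KR2_shape ⟸ G ∧ P ∧ M`
# (decomp-a2c, lens-5 «finite/base range + asymptotic regime + bridge», gen 29; critic row 401 (4)(5), TAG 146 (a′)(c′))

The dichotomy column of record is the tree edge `FDG ⟸ ChargedEnergyGap (14231) ∧ KR2_shape` (p817755,
`FrustratedLawDichotomyTwoShellRigidityDoor`).  `KR2_shape` (= `KR2Shape` below, the door's hypothesis `h2` VERBATIM) is the one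
geometric leaf left open on that column.  This file types the lens-5 cut beneath it — three pieces in the lens currency, each STRICTLY WEAKER
than `KR2Shape`, none a single-shell shape statement (those are refuted: `not_krShape12`, `not_kr`):

* **G = `LinkClassification θ`** (the GLOBAL BASIN, re-typed COMBINATORIALLY so that the jitterbug twist does not touch it; the «generic /
  asymptotic» piece): at a charge-free(θ) site the θ-bond graph induced on the twelve bonded neighbours is, via a bijection `τ` from the fcc or
  the hcp kissing pattern, EXACTLY the pattern's contact graph (`Adj (τ u) (τ v) ↔ dist u v = 1`).  A finite classification of the 4-regular
  θ-contact graphs of near-kissing dozens (12 directions pairwise `≥ 59.35°`, contacts `≤ 60.66°`, non-contacts `> 59.67°` at `θ = 1/100`):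
  the link drawing is planar; vertices with `≥ 3` triangles are excluded by the angle budget (`3·71.89° + 143.51° = 359.2° < 360°` at
  `θ = 1/100`); the link is 4-regular by definition of `IsChargeFree` (ring numbers `= 4`) and connected, and the complete enumeration of
  connected simple 4-regular plane maps on 12 vertices (13 classes: 5 octahedrites, 5 with pentagons, 3 with two hexagons, none with a face
  `≥ 7`; lens-5 g29 NODE §3) leaves after the angle-budget corner rules exactly the cuboctahedron, the anticuboctahedron and the hexagonal
  antiprism, the last metrically infeasible (numerical margin `5.46°`) — INSTRUMENTABLE (certify the angle table, cross-check the
  enumeration, exclude the antiprism; census TAG 146 (c′)).  The twisted dozen SATISFIES G.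
* **P = `CapForcing θ`** (the BRIDGE): at a two-shell charge-free site whose own link and whose neighbours' links are classified, every
  square of the link (pattern pair at distance `√2` = square diagonal; both patterns have exactly 6 squares = the 12 `√2`-pairs, checked
  exactly in `scripts/patterns_exact.py`) carries a CAP: a site `m ≠ i` bonded to all four vertices of the square.  ATTACKABLE by elementary
  metric geometry: at an alternating corner `w` of a square `(u,w,v,w')` the classified link of `τ w` pairs its two squares at `i` either
  crystal-like `{(u,v),(r,t)}` (⟹ a common neighbour `x ≠ i` of `τu, τv, τw`, forced onto the cap position by `7/10`-type relative separation)
  or twisted `{(u,t),(r,v)}` (⟹ a thirteenth site within `1.18·nn_i` of `i`, impossible because every direction lies within `46.2°` of a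
  link direction while `52.5°` clearance would be needed); at a `3².4²` corner the pairing is unique.  This is exactly where prover hand 2's
  caution (INBOX l.429: «cap-free completions are the global-basin question») is discharged — as a separate, typed piece.
* **M = `CappedRigidity θ η`** (the FINITE RANGE / LOCAL piece): link isomorphism + caps ⟹ the bonded dozen lies within `η'·nn_i`, `η' < η`,
  of `nn_i·A(pattern)` for a linear isometry `A` — the conclusion of `KR2Shape` for that `τ`.  The capped `19`-point framework is first-order
  rigid (lens-5 MEASURED 28b: rank `51/51`, `σ_min = 0.744 / 0.745`, worst deviation `0.034 / 0.030` at `θ = 1/100` against `η = 1/20`: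
  margin `1.5×`; `3×` at `θ = 1/200`) — INSTRUMENTABLE by a kernel-replayed ℚ-certificate (census TAG 146 (a′); hand 2's ℚ-mirror), not a
  hand proof at `θ = 1/100`.
* `kr2Shape_of_cut : LinkClassification (1/100) → CapForcing (1/100) → CappedRigidity (1/100) (1/20) → KR2Shape` (pure chaining), and the
  by-name corollaries through the door: `aperiodicFrustratedLawGap_of_cut`, `noFrustratedPeriodicMinimiser_of_cut`.
`θ`, `η` are kept symbolic in G/P/M so that the `θ = 1/200` fallback literal is served by the same pieces.  No `sorry`, no new axioms,
no `instance`/`notation`; `[folklore]` bookkeeping only — the three pieces are the open content.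
-/

noncomputable section

namespace Summit.AtomisticToContinuum.Crystallization.Theorems.FrustratedLawDichotomyTwoShellRigidityCut

open Literature.Geometry.DiscreteGeometry
open Summit.AtomisticToContinuum.Crystallization.Theses.PricedLinkCensus (ChargedEnergyGap)
open Summit.AtomisticToContinuum.Crystallization.Theorems.FrustratedLawDichotomyTwoShellRigidityDoor
  (aperiodicFrustratedLawGap_of_chargedEnergyGap_of_kr2Shape noFrustratedPeriodicMinimiser_of_chargedEnergyGap_of_kr2Shape)

/-- Euclidean 3-space (local abbreviation; no notation). -/
abbrev E3 : Type := EuclideanSpace ℝ (Fin 3)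

/-- **`KR2Shape`** — the door's hypothesis `h2` (p817755), VERBATIM: at a charge-free(1/100) site all of whose 1/100-bonded neighbours are
charge-free(1/100), the bonded dozen, bijectively indexed by the fcc or the hcp kissing pattern, lies within `η·nn_i` (`η < 1/20`) of
`nn_i·A(pattern)` for a linear isometry `A`. [target leaf of the dichotomy column; open] -/
def KR2Shape : Prop :=
  ∀ (N : ℕ) (y : Fin N → EuclideanSpace ℝ (Fin 3)), Function.Injective y → (∀ a b : Fin N, a ≠ b → (7 : ℝ) / 10 ≤ dist (y a) (y b)) → ∀ i : Fin N, Literature.Geometry.DiscreteGeometry.IsChargeFree (1 / 100 : ℝ) y i → (∀ j : Fin N, (Literature.Geometry.DiscreteGeometry.bondGraph (1 / 100 : ℝ) y).Adj i j → Literature.Geometry.DiscreteGeometry.IsChargeFree (1 / 100 : ℝ) y j) → ∃ (η : ℝ) (A : EuclideanSpace ℝ (Fin 3) →ₗᵢ[ℝ] EuclideanSpace ℝ (Fin 3)), η < 1 / 20 ∧ ((∃ τ : ↥Literature.Geometry.DiscreteGeometry.fccKissingPattern → Fin N, (∀ u : ↥Literature.Geometry.DiscreteGeometry.fccKissingPattern,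 (Literature.Geometry.DiscreteGeometry.bondGraph (1 / 100 : ℝ) y).Adj i (τ u)) ∧ (∀ k : Fin N, (Literature.Geometry.DiscreteGeometry.bondGraph (1 / 100 : ℝ) y).Adj i k → ∃ u : ↥Literature.Geometry.DiscreteGeometry.fccKissingPattern, τ u = k) ∧ (∀ u : ↥Literature.Geometry.DiscreteGeometry.fccKissingPattern, ‖(y (τ u) - y i) - Literature.Geometry.DiscreteGeometry.nearestDist y i • A (u : EuclideanSpace ℝ (Fin 3))‖ ≤ η * Literature.Geometry.DiscreteGeometry.nearestDist y i)) ∨ (∃ τ : ↥Literature.Geometry.DiscreteGeometry.hcpKissingPattern → Fin N, (∀ u : ↥Literature.Geometry.DiscreteGeometry.hcpKissingPattern, (Literature.Geometry.DiscreteGeometry.bondGraph (1 / 100 : ℝ) y).Adj i (τ u)) ∧ (∀ k : Fin N, (Literature.Geometry.DiscreteGeometry.bondGraph (1 / 100 : ℝ) y).Adj i k → ∃ u : ↥Literature.Geometry.DiscreteGeometry.hcpKissingPattern, τ u = k) ∧ (∀ u : ↥Literature.Geometry.DiscreteGeometry.hcpKissingPattern, ‖(y (τ u) - y i) - Literature.Geometry.DiscreteGeometry.nearestDist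 y i • A (u : EuclideanSpace ℝ (Fin 3))‖ ≤ η * Literature.Geometry.DiscreteGeometry.nearestDist y i)))

/-- **Link isomorphism** at site `i` with the kissing pattern `Pat` via `τ : Pat → Fin N`: `τ` lands in the `θ`-bonded neighbours of `i`,
hits every one of them, and carries pattern CONTACTS (`dist u v = 1`) exactly onto `θ`-bonds.  (For a charge-free `i` — twelve neighbours,
`|Pat| = 12` — `τ` is then a bijection onto the neighbour set; the third clause says the induced bond graph on the link IS the
cuboctahedron / anticuboctahedron graph.  Purely combinatorial: no metric fit is asserted.) -/
def LinkIso (θ : ℝ) (Pat : Finset E3) {N : ℕ} (y : Fin N → E3) (i : Fin N) (τ : ↥Pat → Fin N) : Prop :=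
  (∀ u : ↥Pat, (bondGraph θ y).Adj i (τ u)) ∧ (∀ k : Fin N, (bondGraph θ y).Adj i k → ∃ u : ↥Pat, τ u = k) ∧
    (∀ u v : ↥Pat, (bondGraph θ y).Adj (τ u) (τ v) ↔ dist (u : E3) (v : E3) = 1)

/-- **G = `LinkClassification θ` — the GLOBAL BASIN, combinatorial form** [GLOBAL · WEAKER than `KR2Shape` · INSTRUMENTABLE;
single-shell but NOT a shape statement: the twisted dozen of `not_krShape12` satisfies it].  At every charge-free(θ) site of an injective
(`7/10`-separated) configuration the θ-bond graph induced on the twelve bonded neighbours is isomorphic, via a bijection from the fcc or the hcp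
kissing pattern, to that pattern's contact graph.  Why it might fail: only if the `θ = 1/100` angle table (corner-rule margin `0.8°`) or the
13-class map enumeration of lens-5 g29 is wrong, or the hexagonal antiprism `(3.3.3.6)¹²` is realizable inside the windows (numerically
infeasible by `5.46°`).  Sources: lens-5 g29 NODE §3, `scripts/angles.py`, `scripts/octahedrites.py`, `scripts/bigfaces.py`; Musin–Tarasov (Tammes 13/14
contact-graph enumeration, arXiv:1002.1439, arXiv:1410.2536); Kusner–Kusner–Lagarias–Shlosman arXiv:1611.10297 (twelve spheres). -/
def LinkClassification (θ : ℝ) : Prop :=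
  ∀ (N : ℕ) (y : Fin N → E3), Function.Injective y → (∀ a b : Fin N, a ≠ b → (7 : ℝ) / 10 ≤ dist (y a) (y b)) →
    ∀ i : Fin N, IsChargeFree θ y i →
      (∃ τ : ↥fccKissingPattern → Fin N, LinkIso θ fccKissingPattern y i τ) ∨
        (∃ τ : ↥hcpKissingPattern → Fin N, LinkIso θ hcpKissingPattern y i τ)

/-- **Caps.**  Every square of the link of `i` (a pattern pair `u, v` at distance `√2` — in both kissing patterns these are exactly the
diagonals of the six squares, the other two vertices of the square being the two common contacts of `u` and `v`) carries a CAP: a site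
`m ≠ i` that is θ-bonded to `τ` of all four vertices of the square.  (In fcc / hcp the cap is the second-shell site `u + v` at distance
`√2·nn_i`.) -/
def Capped (θ : ℝ) (Pat : Finset E3) {N : ℕ} (y : Fin N → E3) (i : Fin N) (τ : ↥Pat → Fin N) : Prop :=
  ∀ u v : ↥Pat, dist (u : E3) (v : E3) = Real.sqrt 2 →
    ∃ m : Fin N, m ≠ i ∧ ∀ w : ↥Pat, (w = u ∨ w = v ∨ (dist (w : E3) (u : E3) = 1 ∧ dist (w : E3) (v : E3) = 1)) →
      (bondGraph θ y).Adj m (τ w)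

/-- **P at one pattern** (`CapForcing` is the conjunction over the two patterns): at a charge-free(θ) site `i` all of whose θ-bonded
neighbours are charge-free(θ), whose link is `Pat`-isomorphic via `τ` and whose neighbours' links are each fcc- or hcp-isomorphic, the link
is capped. -/
def CapForcingAt (θ : ℝ) (Pat : Finset E3) : Prop :=
  ∀ (N : ℕ) (y : Fin N → E3) (i : Fin N) (τ : ↥Pat → Fin N), Function.Injective y →
    (∀ a b : Fin N, a ≠ b → (7 : ℝ) / 10 ≤ dist (y a) (y b)) → IsChargeFree θ y i →
      (∀ j : Fin N, (bondGraph θ y).Adj i j → IsChargeFree θ y j) → LinkIso θ Pat y i τ →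
        (∀ j : Fin N, (bondGraph θ y).Adj i j →
          (∃ τ' : ↥fccKissingPattern → Fin N, LinkIso θ fccKissingPattern y j τ') ∨
            (∃ τ' : ↥hcpKissingPattern → Fin N, LinkIso θ hcpKissingPattern y j τ')) →
          Capped θ Pat y i τ

/-- **P = `CapForcing θ` — the BRIDGE** [BRIDGE · WEAKER than `KR2Shape` · ATTACKABLE (elementary metric geometry: corner pairing
dichotomy + «no thirteenth site within `1.18·nn_i`» + relative separation on the cap circle; margins `46.2°` vs `52.5°`, `±3.4°` on the cap
circle at `θ = 1/100`)].  Why it might fail: a two-shell charge-free arrangement in which some alternating corner is paired the twisted way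
without producing a thirteenth near neighbour — the census's cap-free completion search (TAG 146 (c′)) is its cheapest falsifier.
Sources: lens-5 g29 NODE §P; hand 2 INBOX l.429. -/
def CapForcing (θ : ℝ) : Prop :=
  CapForcingAt θ fccKissingPattern ∧ CapForcingAt θ hcpKissingPattern

/-- **M at one pattern**: link isomorphism + caps ⟹ the bonded dozen fits `nn_i·A(Pat)` within `η'·nn_i` for some `η' < η` and some linear
isometry `A` (the conclusion of `KR2Shape` for this `τ`). -/
def CappedRigidityAt (θ η : ℝ) (Pat : Finset E3) : Prop :=
  ∀ (N : ℕ) (y : Fin N → E3) (i : Fin N) (τ : ↥Pat → Fin N), Function.Injective y →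
    (∀ a b : Fin N, a ≠ b → (7 : ℝ) / 10 ≤ dist (y a) (y b)) → LinkIso θ Pat y i τ → Capped θ Pat y i τ →
      ∃ (η' : ℝ) (A : E3 →ₗᵢ[ℝ] E3), η' < η ∧ ∀ u : ↥Pat, ‖(y (τ u) - y i) - nearestDist y i • A (u : E3)‖ ≤ η' * nearestDist y i

/-- **M = `CappedRigidity θ η` — the FINITE-RANGE / LOCAL piece** [LOCAL · WEAKER than `KR2Shape` · INSTRUMENTABLE, certificate class:
the capped `19`-point framework (centre, twelve, six caps; `12 + 24 + 24 = 60` bond windows `[nn_i/(1+θ)², (1+θ)²·nn_i]`, radial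
`[nn_i, (1+θ)·nn_i]`) is first-order rigid — lens-5 MEASURED 28b: rank `51/51`, `σ_min = 0.744 (fcc) / 0.745 (hcp)`, worst deviation
`0.034 / 0.030` at `θ = 1/100` (margin `1.5×` below `1/20`), `0.017 / 0.016` at `θ = 1/200`].  Why it might fail: the sup of the deviation
over the full window box (not the linearisation) exceeds `1/20` at `θ = 1/100` — then the `θ = 1/200` literal is the fallback.  Sources: lens-5
g28 `kr/MEMO-KR-shape-scoping.md` §4, `kr/scripts/capped_dev.py`; census TAG 146 (a′). -/
def CappedRigidity (θ η : ℝ) : Prop :=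
  CappedRigidityAt θ η fccKissingPattern ∧ CappedRigidityAt θ η hcpKissingPattern

/-- **THE CUT.**  `G ∧ P ∧ M ⟹ KR2Shape` at the registered literals `θ = 1/100`, `η < 1/20` — pure chaining: G classifies the link of `i`
(and, the neighbours being charge-free, of each neighbour), P caps it, M fits it. [folklore] -/
theorem kr2Shape_of_cut (hG : LinkClassification (1 / 100)) (hP : CapForcing (1 / 100))
    (hM : CappedRigidity (1 / 100) (1 / 20)) : KR2Shape := by
  intro N y hy hsep i hcf hcf2
  have hnb : ∀ j : Fin N, (bondGraph (1 / 100 : ℝ) y).Adj i j →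
      (∃ τ' : ↥fccKissingPattern → Fin N, LinkIso (1 / 100) fccKissingPattern y j τ') ∨
        (∃ τ' : ↥hcpKissingPattern → Fin N, LinkIso (1 / 100) hcpKissingPattern y j τ') :=
    fun j hj => hG N y hy hsep j (hcf2 j hj)
  rcases hG N y hy hsep i hcf with ⟨τ, hL⟩ | ⟨τ, hL⟩
  · obtain ⟨η', A, hη', hfit⟩ := hM.1 N y i τ hy hsep hL (hP.1 N y i τ hy hsep hcf hcf2 hL hnb)
    exact ⟨η', A, hη', Or.inl ⟨τ, hL.1, hL.2.1, hfit⟩⟩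
  · obtain ⟨η', A, hη', hfit⟩ := hM.2 N y i τ hy hsep hL (hP.2 N y i τ hy hsep hcf hcf2 hL hnb)
    exact ⟨η', A, hη', Or.inr ⟨τ, hL.1, hL.2.1, hfit⟩⟩

/-- **Through the door, BY NAME: `AperiodicFrustratedLawGap` (crux of item 27623) from `MuEquilibriumDoor ∧ ChargedEnergyGap ∧ G ∧ P ∧ M`.**
[folklore] -/
theorem aperiodicFrustratedLawGap_of_cut
    (hDoor : Summit.AtomisticToContinuum.Crystallization.Theses.GrainCoreNetworkSplit.MuEquilibriumDoor) (hgap : ChargedEnergyGap)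
    (hG : LinkClassification (1 / 100)) (hP : CapForcing (1 / 100)) (hM : CappedRigidity (1 / 100) (1 / 20)) :
    Summit.AtomisticToContinuum.Crystallization.Theses.FrustratedLawDichotomy.AperiodicFrustratedLawGap :=
  aperiodicFrustratedLawGap_of_chargedEnergyGap_of_kr2Shape hDoor hgap (kr2Shape_of_cut hG hP hM)

/-- **DOOR-FREE, BY NAME: `NoFrustratedPeriodicMinimiser` (item 26654) from `ChargedEnergyGap ∧ G ∧ P ∧ M`.** [folklore] -/
theorem noFrustratedPeriodicMinimiser_of_cut (hgap : ChargedEnergyGap)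
    (hG : LinkClassification (1 / 100)) (hP : CapForcing (1 / 100)) (hM : CappedRigidity (1 / 100) (1 / 20)) :
    Summit.AtomisticToContinuum.Crystallization.Theses.PeriodicChargeSplit.NoFrustratedPeriodicMinimiser :=
  noFrustratedPeriodicMinimiser_of_chargedEnergyGap_of_kr2Shape hgap (kr2Shape_of_cut hG hP hM)

/-- Monotonicity in the goodness radius: `CappedRigidity θ η → CappedRigidity θ η₂` for `η ≤ η₂` (so a certificate at any `η ≤ 1/20`
serves the cut). [folklore] -/
theorem cappedRigidity_mono {θ η η₂ : ℝ} (hle : η ≤ η₂) (h : CappedRigidity θ η) : CappedRigidity θ η₂ := by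
  refine ⟨fun N y i τ hy hsep hL hC => ?_, fun N y i τ hy hsep hL hC => ?_⟩
  · obtain ⟨η', A, hη', hfit⟩ := h.1 N y i τ hy hsep hL hC
    exact ⟨η', A, lt_of_lt_of_le hη' hle, hfit⟩
  · obtain ⟨η', A, hη', hfit⟩ := h.2 N y i τ hy hsep hL hC
    exact ⟨η', A, lt_of_lt_of_le hη' hle, hfit⟩

end Summit.AtomisticToContinuum.Crystallization.Theorems.FrustratedLawDichotomyTwoShellRigidityCut

end
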